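import Summits.QuantumFields.YangMills.Theorems.BalabanUVNodesN11RunGuardOfFlowControl
import Summits.QuantumFields.YangMills.Theorems.BalabanUVNodesN11OneBlockLevels

/-!
# DAG node N11 — THE TWO-REGIME SPLIT OF A (2.6)-RUN: along a windowed run satisfying [III] (2.6) at a power-of-`L` basic cube there is a LAST COMPATIBLE LEVEL `n₀ ≤ K` —
# print's compatible partitions hold up to `n₀` (`PartCompat₁₃ θ p n₀`) and EVERY level above `n₀` is ONE-BLOCK (its 𝐃-cube exceeds the torus); `n₀` is located within one level
# from above by the last coupling: every level whose room `L^{m+K−n−a}` is below `log g_K⁻² − 2·log(1+β₀)` is one-block ((2.6)'s second half `g_n ≤ (1+β₀)·g_K`)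

HEADER — WORK-UNIT METADATA.  Cell `pub-ymgap`, YM-PLAN Track A (HUMAN RULING D-0062 ∕ D-0149 width seats), seat `pub-ymgap-dag-n11-w4` (g5; WIDTH SEAT 4 of 4 on NODE n11
[B14]), route `BalabanUVNodes` rev 29, deciding item K1⁹ `StabilityBRunRowsAtRecordR13SepCoPHV` = stmt-QuantumFields-27364 (helper lane, `--kind proof --supports 27364 --as helper`,
count-neutral).  [III] = [Balaban1988Convergent], [I] = [Balaban1987RG1].  Over this seat's `…N11RunGuardOfFlowControl` (★★★ `partCompat₁₃_of_dvdAt_of_window_of_flowIneq26`: under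
(2.6) the compatible levels are an initial segment; `not_dvdAt_mono_of_flowIneq26`; `le_one_add_mul_top_of_flowIneq26`), p618164 `…N11OneBlockLevels` (`dCubeSide_dvd_or_lt`: at
`M = L^a` every level is compatible OR one-block; `not_partCompat₁₃_of_oneBlock`), p608879 `…N11PartCompatOfCouplings` (`log_pow_le_of_dCubeSide_le`, `sitesPerDir_zero_eq`).

WHY THIS FILE.  p618164 located the level-wise dichotomy «compatible or one-block» at `M = L^a` and the BG-ONEBLOCK road (p624439 ∕ dag-n11-w5 ∕ dag-n11-w1's bg-facts faces) serves the
one-block levels; `…N11RunGuardOfFlowControl` showed that under N11's own antecedent (2.6) the non-fitting levels are UPWARD CLOSED.  Together: every windowed (2.6)-run SPLITS at a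
last compatible level `n₀` — print's regime `1 … n₀` (all 𝐃_j-partitions divide the torus, [III] p.257 verbatim) followed by a one-block tail `n₀+1 … K` (every 𝐃_n-partition is the
whole torus).  A chain-level induction over `k < K` (the no-expansion 𝐓-step, K0's row P11, the witness chain) can therefore run print's geometry up to `n₀` and the one-block
geometry after it, instead of carrying a per-level case split; and `n₀` is pinned by the LAST coupling alone up to one level (§2): with (2.6)'s second half `g_n ≤ (1+β₀)·g_K` a
level whose room `L^{m+K−n−a}` is below `log g_K⁻² − 2·log(1+β₀)` is one-block, the initial segment itself being `…RunGuardOfFlowControl`'s (a level whose 𝐃-cube fits carries all lower levels).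

WHAT THIS FILE PROVES (0 `sorry`, 0 `def`; standard axioms).
§1 `oneBlock_iff_not_dvd_of_powM` (p618164's dichotomy as an iff) · ★★ `oneBlock_mono_of_flowIneq26` (one-block levels are upward closed) · ★★★ `exists_lastCompatibleLevel_of_window_of_flowIneq26`
   (generic θ, `M = L^a`, `r = 1`, window `]0,γ]`, (2.6) with `0 ≤ β⁺`, `β⁺γ² ≤ 1`: `∃ n₀ ≤ K, PartCompat₁₃ θ p n₀ ∧ ∀ n, n₀ < n ≤ K → sitesPerDir 0 < dCubeSide … n`) · ★★
   `exists_lastCompatibleLevel_iff_of_window_of_flowIneq26` (sharp form: `PartCompat₁₃ θ p n ⟺ n ≤ n₀` for `n ≤ K`).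
§2 ★★ `not_dvdAt_of_pow_lt_logPow` (ANY run, `M = L^a`: `L^{m+K−n−a} < (log g_n⁻²)^r` ⇒ level `n` does not fit; p608879) · ★★ `not_dvdAt_of_pow_lt_log_top_of_flowIneq26` ((2.6)'s
   second half, `r = 1`: `L^{m+K−n−a} < log g_K⁻² − 2·log(1+β₀)`, `0 ≤ β₀`, `n < K` ⇒ level `n` does not fit, i.e. is one-block at `M = L^a`) · ★★
   `partCompat₁₃_of_log_top_add_le_pow_of_flowIneq26` (from below: `n + a ≤ m + K`, `log g_K⁻² + (K − n) ≤ L^{m+K−n−a}` ⇒ `PartCompat₁₃ θ p n` — `n₀` pinned by `g_K` from both sides).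
§3 at a world whose run couplings are the record's, from the LEAVES `smallCouplings` + `flowControl`: ★★★ `exists_lastCompatibleLevel_of_smallCouplings_of_flowControl`.

HONEST FRAMING.  Helper lane of K1⁹; count-neutral kernel bookkeeping + elementary real∕natural-number arithmetic; (2.6), the window, `M = L^a` are HYPOTHESES (the leaves are
binders of `Dag.B14_main`, asserted by nobody); nothing of Bałaban asserted; NOT a discharge.  N11 NOT discharged; K1⁹ NOT closed, no registered stub of v9 touched; counts unmoved
(typed 28∕28 · discharged 5∕27 · A 5∕28).  One finite `𝕋⁴_{L^K}` programme at fixed `ε = L^{−K}`; R4 closes only the conditional finite-𝕋⁴ rung `BalabanLadder.UV` — NOT ℝ⁴, NOT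
OS, NOT a mass gap, NOT Clay.  No `sorry`, `axiom`, `def`, `instance`, `notation`.  Sources (SHAPE ∕ bookkeeping only): [III] (2.6) p.255, (2.1) p.254, (2.5) p.255, p.257; [I] (0.1)
p.251, Thm 1 p.259.
-/

noncomputable section

namespace Summit.QuantumFields.YangMills.Theorems.BalabanUVNodesN11CompatibleInitialSegmentSplit

open Literature.MathematicalPhysics.QuantumFieldTheory.Balaban1983to89 T4Continuum Node00 DagBinding
open BalabanUVNodesN11PartCompatOfCouplings (log_pow_le_of_dCubeSide_le sitesPerDir_zero_eq)
open BalabanUVNodesN11OneBlockLevels (dCubeSide_dvd_or_lt not_partCompat₁₃_of_oneBlock)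
open BalabanUVNodesN11RunGuardOfFlowControl (partCompat₁₃_of_dvdAt_of_window_of_flowIneq26 not_dvdAt_mono_of_flowIneq26 le_one_add_mul_top_of_flowIneq26
  log_inv_sq_le_log_inv_sq_add_of_upperRunning inv_sq_le_inv_sq_add_of_flowIneq26 partCompat₁₃_of_logFloorAt_of_window_of_upperRunningAt)

variable {F : T4Family} {N : ℕ} [NeZero N]

/-! ## §1  The last compatible level and the one-block tail -/

section Split

/-- **AT `M = L^a`: ONE-BLOCK ⟺ NOT FITTING** — p618164's dichotomy `dCubeSide_dvd_or_lt` read as an iff: the level-`j` 𝐃-cube exceeds the torus period iff it does not divide it.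
[cite: Balaban1988Convergent, (2.1) p.254, (2.5) p.255, p.257; Balaban1987RG1, (0.1) p.251] -/
theorem oneBlock_iff_not_dvd_of_powM (θ : Stage13Params F N) {a : ℕ} (hM : θ.τ9.M = F.L ^ a) (p : B12.RunParams) (j : ℕ) :
    (F.P p.K).sitesPerDir 0 < dCubeSide (F.P p.K).L θ.τ9.M (RkOfRecord (F.P p.K).L θ.ν.r (gOfRecord₁₃ F N θ p j)) j ↔
      ¬ dCubeSide (F.P p.K).L θ.τ9.M (RkOfRecord (F.P p.K).L θ.ν.r (gOfRecord₁₃ F N θ p j)) j ∣ (F.P p.K).sitesPerDir 0 :=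
  ⟨fun hlt hdvd => absurd (Nat.le_of_dvd (Nat.pos_of_ne_zero ((F.P p.K).sitesPerDir_ne_zero 0)) hdvd) (not_le.mpr hlt),
    fun h => (dCubeSide_dvd_or_lt θ hM p j).resolve_left h⟩

/-- **★★ UNDER (2.6) THE ONE-BLOCK LEVELS ARE UPWARD CLOSED** (generic θ, `M = L^a`, `r = 1`, window `]0, γ]`, (2.6) with `0 ≤ β⁺`, `β⁺·γ² ≤ 1`): if the level-`i` 𝐃-cube exceeds
the torus (`1 ≤ i`), so does the level-`n` cube for every `n` with `i ≤ n ≤ K`. [cite: Balaban1988Convergent, (2.6) p.255, (2.1) p.254, p.257; Balaban1987RG1, (0.1) p.251] -/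
theorem oneBlock_mono_of_flowIneq26 (θ : Stage13Params F N) {a : ℕ} (hM : θ.τ9.M = F.L ^ a) (hr : θ.ν.r = 1)
    (p : B12.RunParams) {γ βup β₀ : ℝ} (hβ : 0 ≤ βup) (hβγ : βup * γ ^ 2 ≤ 1)
    (hW : Step.InInterval γ p.K (gOfRecord₁₃ F N θ p))
    (h26 : B14.FlowIneq26 (gOfRecord₁₃ F N θ p) βup β₀ p.K) {i n : ℕ} (h1 : 1 ≤ i) (hin : i ≤ n) (hnK : n ≤ p.K)
    (hi : (F.P p.K).sitesPerDir 0 < dCubeSide (F.P p.K).L θ.τ9.M (RkOfRecord (F.P p.K).L θ.ν.r (gOfRecord₁₃ F N θ p i)) i) :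
    (F.P p.K).sitesPerDir 0 < dCubeSide (F.P p.K).L θ.τ9.M (RkOfRecord (F.P p.K).L θ.ν.r (gOfRecord₁₃ F N θ p n)) n :=
  (oneBlock_iff_not_dvd_of_powM θ hM p n).2
    (not_dvdAt_mono_of_flowIneq26 θ hM hr p hβ hβγ hW h26 h1 hin hnK ((oneBlock_iff_not_dvd_of_powM θ hM p i).1 hi))

/-- **★★★ THE TWO-REGIME SPLIT OF A (2.6)-RUN** (generic θ, `M = L^a`, `r = 1`, window `]0, γ]`, (2.6) with `0 ≤ β⁺`, `β⁺·γ² ≤ 1`): there is a LAST COMPATIBLE LEVEL `n₀ ≤ K` — the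
run is partition-compatible up to `n₀` (print's p. 257 «all partitions compatible» for the scales `1, …, n₀`) and EVERY level `n₀ < n ≤ K` is ONE-BLOCK (its 𝐃_n-cube exceeds the torus,
so every union of 𝐃_n-cubes is `∅` or the whole torus, p618164).  (`n₀` = the greatest level `≤ K` whose cube fits, `0` if none; initial segment by `…RunGuardOfFlowControl`, tail by
p618164's dichotomy.) [cite: Balaban1988Convergent, (2.6) p.255, (2.1) p.254, (2.5) p.255, p.257; Balaban1987RG1, (0.1) p.251, Thm 1 p.259] -/
theorem exists_lastCompatibleLevel_of_window_of_flowIneq26 (θ : Stage13Params F N) {a : ℕ} (hM : θ.τ9.M = F.L ^ a) (hr : θ.ν.r = 1)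
    (p : B12.RunParams) {γ βup β₀ : ℝ} (hβ : 0 ≤ βup) (hβγ : βup * γ ^ 2 ≤ 1)
    (hW : Step.InInterval γ p.K (gOfRecord₁₃ F N θ p))
    (h26 : B14.FlowIneq26 (gOfRecord₁₃ F N θ p) βup β₀ p.K) :
    ∃ n₀, n₀ ≤ p.K ∧ PartCompat₁₃ F N θ p n₀ ∧
      ∀ n, n₀ < n → n ≤ p.K → (F.P p.K).sitesPerDir 0 < dCubeSide (F.P p.K).L θ.τ9.M (RkOfRecord (F.P p.K).L θ.ν.r (gOfRecord₁₃ F N θ p n)) n := by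
  classical
  let Q : ℕ → Prop := fun n => dCubeSide (F.P p.K).L θ.τ9.M (RkOfRecord (F.P p.K).L θ.ν.r (gOfRecord₁₃ F N θ p n)) n ∣ (F.P p.K).sitesPerDir 0
  refine ⟨Nat.findGreatest Q p.K, Nat.findGreatest_le p.K, ?_, fun n hlt hnK => ?_⟩
  · by_cases h0 : Nat.findGreatest Q p.K = 0
    · rw [h0]; exact partCompat₁₃_zero F N θ p
    · exact partCompat₁₃_of_dvdAt_of_window_of_flowIneq26 θ hM hr p hβ hβγ hW h26 (Nat.findGreatest_le p.K)
        (Nat.findGreatest_of_ne_zero (P := Q) rfl h0)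
  · exact (oneBlock_iff_not_dvd_of_powM θ hM p n).2 (Nat.findGreatest_is_greatest (P := Q) hlt hnK)

/-- **THE SPLIT IS SHARP**: with `n₀` as above, `PartCompat₁₃ θ p n` holds for `n ≤ n₀` and FAILS for every `n₀ < n ≤ K` (a one-block level kills the guard, p618164).
[cite: Balaban1988Convergent, (2.6) p.255, p.257] -/
theorem exists_lastCompatibleLevel_iff_of_window_of_flowIneq26 (θ : Stage13Params F N) {a : ℕ} (hM : θ.τ9.M = F.L ^ a) (hr : θ.ν.r = 1)
    (p : B12.RunParams) {γ βup β₀ : ℝ} (hβ : 0 ≤ βup) (hβγ : βup * γ ^ 2 ≤ 1)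
    (hW : Step.InInterval γ p.K (gOfRecord₁₃ F N θ p))
    (h26 : B14.FlowIneq26 (gOfRecord₁₃ F N θ p) βup β₀ p.K) :
    ∃ n₀, n₀ ≤ p.K ∧ ∀ n, n ≤ p.K → (PartCompat₁₃ F N θ p n ↔ n ≤ n₀) := by
  obtain ⟨n₀, hn₀, hPC, htail⟩ := exists_lastCompatibleLevel_of_window_of_flowIneq26 θ hM hr p hβ hβγ hW h26
  refine ⟨n₀, hn₀, fun n hnK => ⟨fun h => ?_, fun h j h1 hj => hPC j h1 (hj.trans h)⟩⟩
  by_contra hlt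
  have hlt' : n₀ < n := Nat.lt_of_not_le hlt
  exact not_partCompat₁₃_of_oneBlock θ p (Nat.succ_le_of_lt (Nat.zero_lt_of_lt hlt')) le_rfl (htail n hlt' hnK) h

end Split

/-! ## §2  Locating `n₀` by the last coupling -/

section Locate

/-- **★★ A LEVEL WHOSE ROOM IS BELOW `log g_n⁻²` DOES NOT FIT** (any run, `M = L^a`; contrapositive of p608879 `log_pow_le_of_dCubeSide_le`): if `L^{m+K−n−a} < (log g_n⁻²)^r` then the
level-`n` 𝐃-cube does not divide the torus period (so, at `M = L^a`, the level is one-block). [cite: Balaban1988Convergent, (2.1) p.254, (2.5) p.255, p.257; Balaban1987RG1, (0.1) p.251] -/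
theorem not_dvdAt_of_pow_lt_logPow (θ : Stage13Params F N) {a : ℕ} (hM : θ.τ9.M = F.L ^ a) (p : B12.RunParams) {n : ℕ}
    (hlt : ((F.L ^ (F.m + p.K - n - a) : ℕ) : ℝ) < (Real.log (gOfRecord₁₃ F N θ p n ^ 2)⁻¹) ^ θ.ν.r) :
    ¬ dCubeSide (F.P p.K).L θ.τ9.M (RkOfRecord (F.P p.K).L θ.ν.r (gOfRecord₁₃ F N θ p n)) n ∣ (F.P p.K).sitesPerDir 0 := by
  intro hdvd
  have hL3 : 3 ≤ F.L := by have := F.hL11; omega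
  have hsz : dCubeSide F.L θ.τ9.M (RkOfRecord F.L θ.ν.r (gOfRecord₁₃ F N θ p n)) n ≤ 2 * F.L ^ (F.m + p.K) := by
    have h := Nat.le_of_dvd (Nat.pos_of_ne_zero ((F.P p.K).sitesPerDir_ne_zero 0)) hdvd
    rw [sitesPerDir_zero_eq] at h
    simpa only [T4Family.P_L] using h
  exact absurd (log_pow_le_of_dCubeSide_le hL3 hM _ hsz) (not_le.mpr hlt)

/-- **★★ UNDER (2.6)'s SECOND HALF THE LAST COUPLING LOCATES ONE-BLOCK LEVELS** (`M = L^a`, `r = 1`, `0 ≤ β₀`, positive couplings, `n < K`): `g_n ≤ (1 + β₀)·g_K` gives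
`log g_n⁻² ≥ log g_K⁻² − 2·log(1+β₀)`, so a level with `L^{m+K−n−a} < log g_K⁻² − 2·log(1 + β₀)` does not fit — it is one-block. [cite: Balaban1988Convergent, (2.6) p.255, (2.1) p.254, (2.5) p.255, p.257] -/
theorem not_dvdAt_of_pow_lt_log_top_of_flowIneq26 (θ : Stage13Params F N) {a : ℕ} (hM : θ.τ9.M = F.L ^ a) (hr : θ.ν.r = 1)
    (p : B12.RunParams) {βup β₀ : ℝ} (hβ₀ : 0 ≤ β₀) (hpos : ∀ i, i ≤ p.K → 0 < gOfRecord₁₃ F N θ p i)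
    (h26 : B14.FlowIneq26 (gOfRecord₁₃ F N θ p) βup β₀ p.K) {n : ℕ} (hn : n < p.K)
    (hlt : ((F.L ^ (F.m + p.K - n - a) : ℕ) : ℝ) < Real.log (gOfRecord₁₃ F N θ p p.K ^ 2)⁻¹ - 2 * Real.log (1 + β₀)) :
    ¬ dCubeSide (F.P p.K).L θ.τ9.M (RkOfRecord (F.P p.K).L θ.ν.r (gOfRecord₁₃ F N θ p n)) n ∣ (F.P p.K).sitesPerDir 0 := by
  refine not_dvdAt_of_pow_lt_logPow θ hM p ?_
  rw [hr, pow_one]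
  refine hlt.trans_le ?_
  have hgn : 0 < gOfRecord₁₃ F N θ p n := hpos n hn.le
  have hgK : 0 < gOfRecord₁₃ F N θ p p.K := hpos p.K le_rfl
  have hle : gOfRecord₁₃ F N θ p n ≤ (1 + β₀) * gOfRecord₁₃ F N θ p p.K := le_one_add_mul_top_of_flowIneq26 h26 hn
  -- `log g_n⁻² = -2 log g_n ≥ -2 log((1+β₀) g_K) = log g_K⁻² - 2 log(1+β₀)`
  have h1 : Real.log (gOfRecord₁₃ F N θ p n) ≤ Real.log (1 + β₀) + Real.log (gOfRecord₁₃ F N θ p p.K) := by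
    rw [← Real.log_mul (by positivity) hgK.ne']
    exact Real.log_le_log hgn hle
  rw [Real.log_inv, Real.log_inv, Real.log_pow, Real.log_pow]
  push_cast
  linarith

/-- **★★ … AND FROM BELOW: A LEVEL WHOSE ROOM EXCEEDS `log g_K⁻² + (K − n)` IS COMPATIBLE** (generic θ, `M = L^a`, `r = 1`, window `]0, γ]`, (2.6) with `0 ≤ β⁺`, `β⁺·γ² ≤ 1`): the
log-log step (p630366 `log_inv_sq_le_log_inv_sq_add_of_upperRunning`) gives `log g_n⁻² ≤ log g_K⁻² + (K − n)`, so `n + a ≤ m + K` and `log g_K⁻² + (K − n) ≤ L^{m+K−n−a}` put the run's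
compatible prefix at least up to `n` (`PartCompat₁₃ θ p n`) — together with `not_dvdAt_of_pow_lt_log_top_of_flowIneq26` the last compatible level `n₀` is pinned by the LAST coupling from
both sides; in particular the one-block tail is SHORT when `g_K` is just below the floor, whatever `K`. [cite: Balaban1988Convergent, (2.6) p.255, (2.1) p.254, (2.5) p.255, p.257; Balaban1987RG1, (0.1) p.251] -/
theorem partCompat₁₃_of_log_top_add_le_pow_of_flowIneq26 (θ : Stage13Params F N) {a : ℕ} (hM : θ.τ9.M = F.L ^ a) (hr : θ.ν.r = 1)
    (p : B12.RunParams) {γ βup β₀ : ℝ} (hβ : 0 ≤ βup) (hβγ : βup * γ ^ 2 ≤ 1)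
    (hW : Step.InInterval γ p.K (gOfRecord₁₃ F N θ p))
    (h26 : B14.FlowIneq26 (gOfRecord₁₃ F N θ p) βup β₀ p.K) {n : ℕ} (hnK : n ≤ p.K) (hroom : n + a ≤ F.m + p.K)
    (hle : Real.log (gOfRecord₁₃ F N θ p p.K ^ 2)⁻¹ + ((p.K - n : ℕ) : ℝ) ≤ ((F.L ^ (F.m + p.K - n - a) : ℕ) : ℝ)) :
    PartCompat₁₃ F N θ p n := by
  have hpos : ∀ i, i ≤ p.K → 0 < gOfRecord₁₃ F N θ p i := fun i hi => (hW i hi).1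
  have hstep := log_inv_sq_le_log_inv_sq_add_of_upperRunning (hpos n hnK) (hpos p.K le_rfl) (hW p.K le_rfl).2 hβ hβγ
    (Nat.cast_nonneg (p.K - n)) (inv_sq_le_inv_sq_add_of_flowIneq26 h26 hpos hnK le_rfl)
  exact partCompat₁₃_of_logFloorAt_of_window_of_upperRunningAt θ hM hr p hβ hβγ hW hnK
    (fun i hi => inv_sq_le_inv_sq_add_of_flowIneq26 h26 hpos hi hnK) hroom (hstep.trans hle)

end Locate

/-! ## §3  At a world whose run couplings are the record's: the split from the node's own leaves -/

section World

/-- **★★★ THE TWO-REGIME SPLIT FROM N11's OWN ANTECEDENTS**: at `θ.τ9.M = F.L^a`, `θ.ν.r = 1`, a world `w` whose run-`P` couplings are the record's (`(w.C P).flow.g = gOfRecord₁₃ θ P`;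
the CoPH ∕ SepCoPH ∕ SepCoPHV data by their `rfl` faces), with `0 ≤ w.βup`, `w.βup·w.γ² ≤ 1`: the leaves `(leavesP w P).smallCouplings` and `(leavesP w P).flowControl` — both
antecedents of `Dag.B14_main (leavesP w P)` — give a last compatible level `n₀ ≤ K` with `PartCompat₁₃ θ P n₀` and every level above `n₀` one-block.
[cite: Balaban1988Convergent, (2.6) p.255, p.257, Thm 1 p.262; Balaban1987RG1, Thm 1 p.259, (0.1) p.251] -/
theorem exists_lastCompatibleLevel_of_smallCouplings_of_flowControl (θ : Stage13Params F N) {a : ℕ} (hM : θ.τ9.M = F.L ^ a) (hr : θ.ν.r = 1)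
    (w : WorldP) (hβ : 0 ≤ w.βup) (hβγ : w.βup * w.γ ^ 2 ≤ 1) (P : B12.RunParams) (hg : (w.C P).flow.g = gOfRecord₁₃ F N θ P)
    (hsc : (leavesP w P).smallCouplings) (hfc : (leavesP w P).flowControl) :
    ∃ n₀, n₀ ≤ P.K ∧ PartCompat₁₃ F N θ P n₀ ∧
      ∀ n, n₀ < n → n ≤ P.K → (F.P P.K).sitesPerDir 0 < dCubeSide (F.P P.K).L θ.τ9.M (RkOfRecord (F.P P.K).L θ.ν.r (gOfRecord₁₃ F N θ P n)) n := by
  have hW : Step.InInterval w.γ P.K (gOfRecord₁₃ F N θ P) := by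
    have h : Step.InInterval w.γ P.K (w.C P).flow.g := (Step.inInterval_iff _ _ _).1 hsc
    rwa [hg] at h
  have h26 : B14.FlowIneq26 (gOfRecord₁₃ F N θ P) w.βup w.β₀ P.K := by
    have h : B14.FlowIneq26 (w.C P).flow.g w.βup w.β₀ P.K := hfc
    rwa [hg] at h
  exact exists_lastCompatibleLevel_of_window_of_flowIneq26 θ hM hr P hβ hβγ hW h26

end World

end Summit.QuantumFields.YangMills.Theorems.BalabanUVNodesN11CompatibleInitialSegmentSplit

end
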